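import Summits.Ventures.Crystal3D.Theorems.StickyWulffConstantTextureLiminfLayerRows
import Summits.Ventures.Crystal3D.Theorems.StickyWulffConstantTextureLiminfChargeFlux
import HarnessLib

/-!
# The IN-LAYER FLUX COUNT of a clamped Barlow plate: rows with a site in the window ≥ layer flux × volume
# (LAYER-FLUX chain piece 3b, booked cf-p1 ROUTE.md §86(72) BO; crux `TextureLiminf`, stmt-Ventures-19483)

HONEST FRAMING. Venture `Summits/Ventures/Crystal3D` (cell `crystal3d-full`), helper `--supports` the crux
`TextureLiminf` (stmt-Ventures-19483) of `route-Ventures-StickyWulffConstant`, registered line `TexShadow`.  Rung credit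
only; F-C1 not moved.  The in-layer twin of `plate_lines_ge_flux` (`…FluxCount`), simpler: straight rows, no drift.

* **`layer_lines_ge_flux`** — for `S` measurable inside `{z₁ ≤ ⟪p,e⟫ ≤ z₁+1} ∩ cyl ρ'`, `‖e‖ = 1`, `1/4 ≤ τ₀`,
  `H + 1 ≤ z₁ − 3`, and every finite `T ⊆ ℤ²` containing each row `(k, j)` with a site `L(layerSite σ L e k i j) + s`
  (`…LayerRows`) of e-height in `[H, H+1]` within axis distance `ρ' + 4 + 4(z₁ + 4 − H)`:  `layerFlux τ₀ L e · |S| ≤ #T`.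
Proof: slab by slab the prism chart (`…LayerChart`, determinant `√3/2`) writes the volume as an integral over the rows'
transversal coordinates; each row meets the unit e-slab in a segment of length `≤ 1/layerRise`; a row meeting `S` has a
site in the window (heights along a row form a progression of step `layerRise ≤ 1`; lateral displacement `≤ 4` per unit
height); the boxes `[j, j+1) × [0, √(2/3))` have volume `√(2/3)` and `√2 · (√3/2) · √(2/3) = 1`.
WHAT THIS IS NOT: not the walker family, not the cell bound; F-C1 not moved.
-/

noncomputable section

namespace Summit.Ventures.Crystal3D.Theorems


open MeasureTheory Set
open scoped ENNReal InnerProductSpace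
open Literature.MathematicalPhysics.StatisticalMechanics (barlowPos barlowLayer triangularVec₁ triangularVec₂
  barlowPos_apply_two)
open Summit.Ventures.Crystal3D.Cruxes.TextureLiminf.TexShadow (E3 e₃ laySlab stacking layerRise bestLayerAxis bestLayerDir
  layerFlux bestLayerAxis_spec inner_bestLayerDir norm_bestLayerDir bestLayerDir_apply_two layerRise_le_one triangularVec_coords)

/-! ## The in-layer flux count -/

/-- `√3/2 · √(2/3) = √2/2`, the transversal area per in-layer row, as `√2 · (√3/2 · (1/r) · √(2/3)) = 1/r`. -/
theorem sqrt_two_mul_rowArea (r : ℝ) :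
    Real.sqrt 2 * (Real.sqrt 3 / 2 * (1 / r) * Real.sqrt (2 / 3)) = 1 / r := by
  have h := sqrt_two_mul_det
  calc Real.sqrt 2 * (Real.sqrt 3 / 2 * (1 / r) * Real.sqrt (2 / 3))
      = Real.sqrt 2 * (Real.sqrt 3 / 2 * Real.sqrt (2 / 3)) * (1 / r) := by ring
    _ = 1 / r := by rw [h, one_mul]

/-- **THE IN-LAYER FLUX COUNT.**  See the module docstring. -/
theorem layer_lines_ge_flux (σ : ℤ → ℤ) (L : E3 ≃ₗᵢ[ℝ] E3) (s e : E3) (he : ‖e‖ = 1) (τ₀ : ℝ) (hτ₀ : 1 / 4 ≤ τ₀)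
    (ρ' z₁ H : ℝ) (hH : H + 1 ≤ z₁ - 3) (S : Set E3) (hSm : MeasurableSet S)
    (hS : S ⊆ {p : E3 | z₁ ≤ ⟪p, e⟫_ℝ ∧ ⟪p, e⟫_ℝ ≤ z₁ + 1 ∧ Real.sqrt (p 0 ^ 2 + p 1 ^ 2) ≤ ρ'})
    (T : Finset (ℤ × ℤ))
    (hT : ∀ kj : ℤ × ℤ, (∃ i : ℤ,
        H ≤ ⟪L (layerSite σ L e kj.1 i kj.2) + s, e⟫_ℝ ∧ ⟪L (layerSite σ L e kj.1 i kj.2) + s, e⟫_ℝ ≤ H + 1 ∧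
        Real.sqrt ((L (layerSite σ L e kj.1 i kj.2) + s) 0 ^ 2 + (L (layerSite σ L e kj.1 i kj.2) + s) 1 ^ 2) ≤
          ρ' + 4 + 4 * (z₁ + 4 - H)) → kj ∈ T) :
    layerFlux τ₀ L e * (volume S).toReal ≤ T.card := by
  classical
  have hT0 : (0 : ℝ) ≤ T.card := by positivity
  unfold layerFlux
  split_ifs with hlaunch
  swap
  · rw [zero_mul]; exact hT0
  -- notation and basic facts
  set r : ℝ := layerRise L e with hr
  have hr4 : 1 / 4 ≤ r := le_trans hτ₀ hlaunch
  have hr0 : 0 < r := by linarith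
  have hr1 : r ≤ 1 := layerRise_le_one L he
  set ν : E3 := L.symm e with hν
  set w : E3 := bestLayerDir L e with hwdef
  set w' : E3 := bestLayerPartner L e with hw'def
  have hwν : ⟪w, ν⟫_ℝ = r := inner_bestLayerDir L e
  have hw1 : ‖w‖ = 1 := norm_bestLayerDir L e
  have hw'1 : ‖w'‖ = 1 := norm_bestLayerPartner L e
  have hw2 : w 2 = 0 := bestLayerDir_apply_two L e
  have hw'2 : w' 2 = 0 := bestLayerPartner_apply_two L e
  have hdet : w 0 * w' 1 - w 1 * w' 0 = Real.sqrt 3 / 2 := det_bestLayerDir_partner L e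
  have hdet0 : 0 < w 0 * w' 1 - w 1 * w' 0 := by rw [hdet]; positivity
  set hB : ℝ := Real.sqrt (2 / 3) with hBdef
  have hB0 : 0 < hB := Real.sqrt_pos.2 (by norm_num)
  have hB1 : hB ≤ 1 := by
    rw [hBdef, show (1 : ℝ) = Real.sqrt 1 by simp]
    exact Real.sqrt_le_sqrt (by norm_num)
  have he₃1 : ‖(e₃ : E3)‖ = 1 := by rw [e₃, PiLp.norm_single, norm_one]
  -- the model set and gauges
  set S' : Set E3 := (fun q => L q + s) ⁻¹' S with hS'
  have hcont : Continuous fun q : E3 => L q + s := L.continuous.add continuous_const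
  have hS'm : MeasurableSet S' := hcont.measurable hSm
  have hheight : ∀ q : E3, ⟪L q + s, e⟫_ℝ = ⟪q, ν⟫_ℝ + ⟪s, e⟫_ℝ := fun q => by
    rw [inner_add_left, hν, ← LinearIsometryEquiv.inner_map_map L q (L.symm e), LinearIsometryEquiv.apply_symm_apply]
  set lat : E3 → ℝ := fun q => Real.sqrt ((L q + s) 0 ^ 2 + (L q + s) 1 ^ 2) with hlat
  have hlat_sub : ∀ q y : E3, lat (q + y) ≤ lat q + ‖y‖ := by
    intro q y
    have h := sqrt_lateral_add_le (L q + s) (L y)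
    rw [LinearIsometryEquiv.norm_map] at h
    have heq : L (q + y) + s = L q + s + L y := by rw [map_add]; abel
    simp only [hlat, heq]; exact h
  -- the chart is affine in `τ` along `w`
  have hlin : ∀ (Γ : E3) (τ : ℝ) (x : Fin 2 → ℝ), layChart' Γ w w' (τ, x) = τ • w + layChart' Γ w w' (0, x) := by
    intro Γ τ x; simp only [layChart', zero_smul, zero_add]; abel
  -- PER SLAB
  have hslab : ∀ k : ℤ, volume (S ∩ laySlab L s k) ≤
      ENNReal.ofReal (Real.sqrt 3 / 2 * (1 / r) * hB) * ((T.filter fun kj => kj.1 = k).card : ℝ≥0∞) := by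
    intro k
    set Γ : E3 := barlowPos 1 (Real.sqrt (2 / 3)) σ k 0 0 with hΓ
    have hΓ2 : Γ 2 = (k : ℝ) * hB := by rw [hΓ, barlowPos_apply_two]
    have hslabset : {q : E3 | (k : ℝ) * Real.sqrt (2 / 3) < q 2 ∧ q 2 < ((k : ℝ) + 1) * Real.sqrt (2 / 3)} =
        {q : E3 | Γ 2 < q 2 ∧ q 2 < Γ 2 + hB} := by
      ext q; simp only [Set.mem_setOf_eq, hΓ2, hBdef, add_mul, one_mul]
    rw [volume_inter_laySlab_eq_model L s S hSm k, hslabset,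
      volume_inter_slab_eq_lintegral_layChart Γ w w' hw2 hw'2 hdet0 hB S' hS'm, hdet]
    -- the integrand
    set G : (Fin 2 → ℝ) → ℝ≥0∞ := fun x => volume {τ : ℝ | layChart' Γ w w' (τ, x) ∈ S' ∧ 0 < x 1 ∧ x 1 < hB} with hG
    set J : Finset ℤ := (T.filter fun kj => kj.1 = k).image Prod.snd with hJ
    -- (i) each τ-line meets the unit e-slab in a segment of length ≤ 1/r
    have hGC : ∀ x, G x ≤ ENNReal.ofReal (1 / r) := by
      intro x
      set c : ℝ := ⟪L (layChart' Γ w w' (0, x)) + s, e⟫_ℝ with hc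
      have hsub : {τ : ℝ | layChart' Γ w w' (τ, x) ∈ S' ∧ 0 < x 1 ∧ x 1 < hB} ⊆ Icc ((z₁ - c) / r) ((z₁ + 1 - c) / r) := by
        rintro τ ⟨hτS, -, -⟩
        have hq := hS hτS
        simp only [Set.mem_setOf_eq] at hq
        obtain ⟨h1, h2, -⟩ := hq
        have hh : ⟪L (layChart' Γ w w' (τ, x)) + s, e⟫_ℝ = τ * r + c := by
          rw [hlin, hheight, inner_add_left, real_inner_smul_left, hwν, hc, hheight]; ring
        rw [hh] at h1 h2
        rw [Set.mem_Icc, div_le_iff₀ hr0, le_div_iff₀ hr0]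
        exact ⟨by linarith only [h1], by linarith only [h2]⟩
      calc G x ≤ volume (Icc ((z₁ - c) / r) ((z₁ + 1 - c) / r)) := measure_mono hsub
        _ = ENNReal.ofReal (1 / r) := by rw [Real.volume_Icc]; congr 1; field_simp; ring
    -- (ii) a τ-line that meets `S'` has a site in the window, so its row is in `T`
    have hG0 : ∀ x, G x ≠ 0 → 0 ≤ x 1 ∧ x 1 < hB ∧ ⌊x 0⌋ ∈ J := by
      intro x hx
      have hne : {τ : ℝ | layChart' Γ w w' (τ, x) ∈ S' ∧ 0 < x 1 ∧ x 1 < hB}.Nonempty := by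
        by_contra h
        rw [Set.not_nonempty_iff_eq_empty] at h
        exact hx (by simp only [hG, h, measure_empty])
      obtain ⟨τ, hτS, hx0, hx1⟩ := hne
      refine ⟨hx0.le, hx1, ?_⟩
      rw [hJ, Finset.mem_image]
      refine ⟨(k, ⌊x 0⌋), ?_, rfl⟩
      rw [Finset.mem_filter]
      refine ⟨hT (k, ⌊x 0⌋) ?_, rfl⟩
      -- the point of `S`, the row point below it, and the site
      have hq := hS hτS
      simp only [Set.mem_setOf_eq] at hq
      obtain ⟨hq1, hq2, hql⟩ := hq
      set t : ℤ := ⌊x 0⌋ with ht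
      -- row point `q' = Γ + τ w + t w'`; offset `y = frac • w' + x₁ • e₃`, ‖y‖ ≤ 2
      set y : E3 := (x 0 - t) • w' + (x 1) • e₃ with hy
      have hy2 : ‖y‖ ≤ 2 := by
        have hf0 : 0 ≤ x 0 - t := by rw [ht]; linarith [Int.floor_le (x 0)]
        have hf1 : x 0 - t ≤ 1 := by rw [ht]; linarith [Int.lt_floor_add_one (x 0)]
        calc ‖y‖ ≤ ‖(x 0 - t) • w'‖ + ‖(x 1) • e₃‖ := norm_add_le _ _
          _ ≤ 1 + 1 := by
              rw [norm_smul, norm_smul, hw'1, he₃1, mul_one, mul_one, Real.norm_eq_abs, Real.norm_eq_abs,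
                abs_of_nonneg hf0, abs_of_nonneg hx0.le]
              exact add_le_add hf1 (by linarith)
          _ = 2 := by norm_num
      have hqy : layChart' Γ w w' (τ, x) = (Γ + τ • w + (t : ℝ) • w') + y := by
        simp only [layChart', hy]; module
      -- heights along the row: site `i` has height `i * r + c'`
      set c' : ℝ := ⟪L (Γ + (t : ℝ) • w') + s, e⟫_ℝ with hc'
      have hsite : ∀ i : ℤ, layerSite σ L e k i t = Γ + (t : ℝ) • w' + (i : ℝ) • w := by
        intro i; simp only [layerSite, hΓ, hwdef, hw'def]; abel
      have hsite_h : ∀ i : ℤ, ⟪L (layerSite σ L e k i t) + s, e⟫_ℝ = (i : ℝ) * r + c' := by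
        intro i; rw [hsite, hheight, inner_add_left, real_inner_smul_left, hwν, hc', hheight]; ring
      -- height of the row point vs the point of S
      have hrow_h : ⟪L (Γ + τ • w + (t : ℝ) • w') + s, e⟫_ℝ = τ * r + c' := by
        rw [hheight, hc', hheight, show Γ + τ • w + (t : ℝ) • w' = (Γ + (t : ℝ) • w') + τ • w by abel,
          inner_add_left, real_inner_smul_left, hwν]; ring
      have hqh : ⟪L (layChart' Γ w w' (τ, x)) + s, e⟫_ℝ = τ * r + c' + ⟪L y, e⟫_ℝ := by
        rw [hqy, map_add, show L (Γ + τ • w + (t : ℝ) • w') + L y + s = (L (Γ + τ • w + (t : ℝ) • w') + s) + L y by abel,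
          inner_add_left, hrow_h]
      have hLy : |⟪L y, e⟫_ℝ| ≤ 2 := by
        have := abs_real_inner_le_norm (L y) e
        rw [LinearIsometryEquiv.norm_map, he, mul_one] at this
        exact this.trans hy2
      obtain ⟨hLy1, hLy2⟩ := abs_le.1 hLy
      -- the site: `n := ⌊(H + 1 − c')/r⌋`
      set n : ℤ := ⌊(H + 1 - c') / r⌋ with hn
      have hn1 : (n : ℝ) * r + c' ≤ H + 1 := by
        have h1 := Int.floor_le ((H + 1 - c') / r)
        rw [← hn] at h1
        have h2 := mul_le_mul_of_nonneg_right h1 hr0.le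
        rw [div_mul_cancel₀ _ (ne_of_gt hr0)] at h2
        linarith only [h2]
      have hn2 : H ≤ (n : ℝ) * r + c' := by
        have h1 := Int.lt_floor_add_one ((H + 1 - c') / r)
        rw [← hn] at h1
        have h2 := mul_lt_mul_of_pos_right h1 hr0
        rw [div_mul_cancel₀ _ (ne_of_gt hr0)] at h2
        have h3 : ((n : ℝ) + 1) * r = (n : ℝ) * r + r := by ring
        rw [h3] at h2
        linarith only [h2, hr1]
      refine ⟨n, ?_, ?_, ?_⟩
      · rw [hsite_h]; exact hn2
      · rw [hsite_h]; exact hn1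
      · -- lateral: (τ − n) r ≤ z₁ + 3 − H with τ − n ≥ 0, so τ − n ≤ 4 (z₁ + 3 − H); plus the offset 2
        rw [hqh] at hq1 hq2
        have hexp : (τ - n) * r = τ * r - (n : ℝ) * r := by ring
        have hτn1 : 1 ≤ (τ - n) * r := by rw [hexp]; linarith only [hq1, hLy2, hn1, hH]
        have hτn : 0 ≤ τ - n := by
          by_contra hneg
          push Not at hneg
          have hlt : (τ - n) * r < 0 := mul_neg_of_neg_of_pos hneg hr0
          linarith only [hτn1, hlt]
        have hτn2 : (τ - n) * r ≤ z₁ + 3 - H := by rw [hexp]; linarith only [hq2, hLy1, hn2]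
        have h4 : (τ - n) * (1 / 4) ≤ (τ - n) * r := mul_le_mul_of_nonneg_left hr4 hτn
        have hτn3 : τ - n ≤ 4 * (z₁ + 3 - H) := by linarith only [h4, hτn2]
        have hpt : layerSite σ L e k n t = layChart' Γ w w' (τ, x) + (((n : ℝ) - τ) • w - y) := by
          rw [hsite n, hqy]; module
        have hnorm : ‖((n : ℝ) - τ) • w - y‖ ≤ (τ - n) + 2 := by
          calc ‖((n : ℝ) - τ) • w - y‖ ≤ ‖((n : ℝ) - τ) • w‖ + ‖y‖ := norm_sub_le _ _
            _ ≤ (τ - n) + 2 := by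
                rw [norm_smul, hw1, mul_one, Real.norm_eq_abs, abs_sub_comm, abs_of_nonneg hτn]
                linarith
        have hl := hlat_sub (layChart' Γ w w' (τ, x)) (((n : ℝ) - τ) • w - y)
        rw [← hpt] at hl
        change lat (layChart' Γ w w' (τ, x)) ≤ ρ' at hql
        change lat (layerSite σ L e k n t) ≤ ρ' + 4 + 4 * (z₁ + 4 - H)
        linarith only [hl, hql, hnorm, hτn3]
    -- (iii) integrate
    have hint := lintegral_le_card_boxes G (ENNReal.ofReal (1 / r)) hB J hGC hG0
    have hJcard : (J.card : ℝ≥0∞) ≤ ((T.filter fun kj => kj.1 = k).card : ℝ≥0∞) := by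
      exact_mod_cast Finset.card_image_le
    calc ENNReal.ofReal (Real.sqrt 3 / 2) * ∫⁻ x, G x
        ≤ ENNReal.ofReal (Real.sqrt 3 / 2) * (ENNReal.ofReal (1 / r) * (J.card : ℝ≥0∞) * ENNReal.ofReal hB) := by
          gcongr
      _ ≤ ENNReal.ofReal (Real.sqrt 3 / 2) * (ENNReal.ofReal (1 / r) *
            ((T.filter fun kj => kj.1 = k).card : ℝ≥0∞) * ENNReal.ofReal hB) := by gcongr
      _ = ENNReal.ofReal (Real.sqrt 3 / 2 * (1 / r) * hB) * ((T.filter fun kj => kj.1 = k).card : ℝ≥0∞) := by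
          rw [ENNReal.ofReal_mul (by positivity), ENNReal.ofReal_mul (by positivity)]; ring
  -- SUM OVER SLABS
  have hfib : ∑' k : ℤ, ((T.filter fun kj => kj.1 = k).card : ℝ≥0∞) = (T.card : ℝ≥0∞) := by
    rw [tsum_eq_sum (s := T.image Prod.fst)]
    · rw [Finset.card_eq_sum_card_fiberwise (f := Prod.fst) (t := T.image Prod.fst)
        (fun x hx => Finset.mem_image_of_mem _ hx)]
      push_cast
      rfl
    · intro k hk
      have : (T.filter fun kj => kj.1 = k) = ∅ := by
        rw [Finset.filter_eq_empty_iff]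
        intro kj hkj heq
        exact hk (Finset.mem_image.2 ⟨kj, hkj, heq⟩)
      rw [this, Finset.card_empty, Nat.cast_zero]
  have hvol : volume S ≤ ENNReal.ofReal (Real.sqrt 3 / 2 * (1 / r) * hB) * (T.card : ℝ≥0∞) := by
    calc volume S = ∑' k : ℤ, volume (S ∩ laySlab L s k) := measure_eq_tsum_inter_laySlab L s S hSm
      _ ≤ ∑' k : ℤ, ENNReal.ofReal (Real.sqrt 3 / 2 * (1 / r) * hB) * ((T.filter fun kj => kj.1 = k).card : ℝ≥0∞) :=
          ENNReal.tsum_le_tsum hslab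
      _ = ENNReal.ofReal (Real.sqrt 3 / 2 * (1 / r) * hB) * (T.card : ℝ≥0∞) := by
          rw [ENNReal.tsum_mul_left, hfib]
  -- to real numbers
  have hC0 : 0 ≤ Real.sqrt 3 / 2 * (1 / r) * hB := by positivity
  have hreal : (volume S).toReal ≤ Real.sqrt 3 / 2 * (1 / r) * hB * T.card := by
    have h := ENNReal.toReal_mono (by
      exact ENNReal.mul_ne_top ENNReal.ofReal_ne_top (ENNReal.natCast_ne_top _)) hvol
    rw [ENNReal.toReal_mul, ENNReal.toReal_ofReal hC0, ENNReal.toReal_natCast] at h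
    exact h
  have hs2 : 0 ≤ Real.sqrt 2 := Real.sqrt_nonneg 2
  calc Real.sqrt 2 * r * (volume S).toReal
      ≤ Real.sqrt 2 * r * (Real.sqrt 3 / 2 * (1 / r) * hB * T.card) :=
        mul_le_mul_of_nonneg_left hreal (by positivity)
    _ = (Real.sqrt 2 * (Real.sqrt 3 / 2 * (1 / r) * Real.sqrt (2 / 3))) * r * T.card := by rw [hBdef]; ring
    _ = T.card := by rw [sqrt_two_mul_rowArea, one_div, inv_mul_cancel₀ (ne_of_gt hr0), one_mul]


end Summit.Ventures.Crystal3D.Theorems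

end
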